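import Literature.AnabelianGeometry.AbsoluteAnabelian.OuterHomLemmas
import Literature.AnabelianGeometry.AbsoluteAnabelian.AbsTopI.RelativeGCInputs
import HarnessLib

/-!
# Functorial relative anabelian data: the hom-version of the relative GC implies the isom-version

S. Mochizuki, *The local pro-p anabelian geometry of curves* [pGC] (1999), Theorem A p. 3 and its
remark (3) p. 3: "the isomorphisms of `X_K` with `Y_K` are in natural bijective correspondence with the
outer isomorphisms over `Γ_K` of `Π_{X_K}` with `Π_{Y_K}` [...] manifestly a special case of the
profinite version [...] of Theorem A"; [AbsTopI] Def 4.6 (ii) p. 55–56 (rel-isom-DGC / rel-hom-DGC).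

In the tree the relative GC statements are typed MODEL-RELATIVELY over an abstract
`RelativeAnabelianDatum` (`RelativeGrothendieckConjecture.lean`, abc-iut-L4-t13): objects, morphisms,
the flag `IsIso`, and "the natural map" `f ↦ [π₁(f)]` to OUTER homomorphisms over `G` — but no
composition of morphisms.  The word "manifestly" of remark (3) uses exactly the functoriality of
`X ↦ Π_X`: an outer ISOmorphism is an open outer homomorphism, so it and its inverse come from
dominant morphisms `f`, `g`, and `g ∘ f`, `f ∘ g` induce the identity outer homomorphisms, hence are
identities by the injectivity half of the hom-GC.  This file makes that argument kernel-checked: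

* `AugmentedProfiniteGrp.HomOver.id/comp/inv`, `OuterHom.id/comp` (composition descends to the
  `Δ`-inner quotient: `HomOver.comp_conj`, `HomOver.conj_comp`), and the criterion
  `OuterHom.isIso_of_comp_eq_id` (a class with a two-sided inverse class consists of isomorphisms);
* `RelativeAnabelianDatum.Functoriality D` — the (Type-valued) DATA of identities and composition on
  `D.Obj` with the two functoriality laws of `f ↦ [π₁(f)]` and the characterisation of `D.IsIso` as
  two-sided invertibility (an honest interface extension: the étale-`π₁` model supplies it);
* `RelativeAnabelianDatum.relIsom_of_relHom_on` (the core argument, for any class of objects),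
  `relIsomGC_of_relHomGC` ([pGC] remark (3) as a THEOREM modulo functoriality),
  `pGC.thmA_isom_of_thmA` (the named fact `pGC.ThmA_isom` follows from `pGC.ThmA` itself for
  functorial data — compare `pGC.thmA_isom_of_thm_4_12`, which went through [Tpcs] Thm 4.12), and
  `AbsTopI.ConstructionDataClass.relIsomDGC_of_relHomDGC` (for a class `𝒟` all of whose data are
  functorial, the rel-hom-DGC implies the rel-isom-DGC — the reading behind the hypothesis lists of
  `AbsTopI.Thm_4_7_iii_ofMem`, cf. [AbsTopI] Thm 4.7 preamble p. 56 / (iii) p. 57).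

HONEST FRAMING: interface-level category theory; nothing here bears on [IUTchIII] Cor 3.12, and the
GC theorems themselves (`pGC.ThmA`, `Tpcs.Thm_4_12`) remain named facts.
-/

noncomputable section

universe u

namespace Literature.AnabelianGeometry.AbsoluteAnabelian

namespace AugmentedProfiniteGrp

variable {G : ProfiniteGrp.{u}} {A B C D : AugmentedProfiniteGrp G}

namespace HomOver

/-- The identity homomorphism over `G`. [cite: MochizukiLocAn1999, Thm A p.3] -/
protected def id (A : AugmentedProfiniteGrp G) : HomOver A A where
  toHom := ContinuousMonoidHom.id A.arith
  «over» := fun _ => rfl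

/-- Underlying function of the identity. [cite: MochizukiLocAn1999, Thm A p.3] -/
@[simp] theorem id_apply (x : A.arith) : (HomOver.id A).toHom x = x := rfl

/-- Composition of homomorphisms over `G` ("`f ↦ π₁(f)`" is compatible with composition).
[cite: MochizukiLocAn1999, Thm A p.3] -/
def comp (ψ : HomOver B C) (φ : HomOver A B) : HomOver A C where
  toHom := ψ.toHom.comp φ.toHom
  «over» := fun x => by
    change C.aug (ψ.toHom (φ.toHom x)) = A.aug x
    rw [ψ.over, φ.over]

/-- Underlying function of a composite. [cite: MochizukiLocAn1999, Thm A p.3] -/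
@[simp] theorem comp_apply (ψ : HomOver B C) (φ : HomOver A B) (x : A.arith) :
    (ψ.comp φ).toHom x = ψ.toHom (φ.toHom x) := rfl

/-- Right unit law. [cite: MochizukiLocAn1999, Thm A p.3] -/
theorem comp_id (φ : HomOver A B) : φ.comp (HomOver.id A) = φ := HomOver.ext fun _ => rfl

/-- Left unit law. [cite: MochizukiLocAn1999, Thm A p.3] -/
theorem id_comp (φ : HomOver A B) : (HomOver.id B).comp φ = φ := HomOver.ext fun _ => rfl

/-- Associativity. [cite: MochizukiLocAn1999, Thm A p.3] -/
theorem comp_assoc (χ : HomOver C D) (ψ : HomOver B C) (φ : HomOver A B) :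
    (χ.comp ψ).comp φ = χ.comp (ψ.comp φ) := HomOver.ext fun _ => rfl

/-- Post-composition carries a `Δ_B`-conjugate of `φ` to the `Δ_C`-conjugate by the image element
(`ψ(Δ_B) ⊆ Δ_C` since `ψ` lies over `G`). [cite: MochizukiLocAn1999, Thm A p.3] -/
theorem comp_conj (ψ : HomOver B C) (g : B.arith) (hg : g ∈ B.geom) (φ : HomOver A B) :
    ψ.comp (HomOver.conj g hg φ) =
      HomOver.conj (ψ.toHom g) (ψ.apply_mem_geom hg) (ψ.comp φ) := by
  ext x
  simp only [comp_apply, conj_apply, map_mul, map_inv]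

/-- Pre-composition commutes with `Δ_C`-conjugation. [cite: MochizukiLocAn1999, Thm A p.3] -/
theorem conj_comp (g : C.arith) (hg : g ∈ C.geom) (ψ : HomOver B C) (φ : HomOver A B) :
    (HomOver.conj g hg ψ).comp φ = HomOver.conj g hg (ψ.comp φ) := HomOver.ext fun _ => rfl

/-- The identity is an isomorphism. [cite: MochizukiTopics2003, Thm 4.12 p.44] -/
theorem isIso_id : (HomOver.id A).IsIso := Function.bijective_id

/-- Isomorphisms compose. [cite: MochizukiTopics2003, Thm 4.12 p.44] -/
theorem IsIso.comp {ψ : HomOver B C} {φ : HomOver A B} (hψ : ψ.IsIso) (hφ : φ.IsIso) :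
    (ψ.comp φ).IsIso := by
  change Function.Bijective (fun x => ψ.toHom (φ.toHom x))
  exact Function.Bijective.comp hψ hφ

/-- The underlying multiplicative equivalence of an isomorphism over `G`.
[cite: MochizukiTopics2003, Thm 4.12 p.44] -/
def IsIso.mulEquiv {φ : HomOver A B} (h : φ.IsIso) : A.arith ≃* B.arith :=
  MulEquiv.ofBijective φ.toHom.toMonoidHom h

/-- The equivalence of an isomorphism is the homomorphism. [cite: MochizukiTopics2003, Thm 4.12 p.44] -/
@[simp] theorem IsIso.mulEquiv_apply {φ : HomOver A B} (h : φ.IsIso) (x : A.arith) :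
    h.mulEquiv x = φ.toHom x := rfl

/-- The INVERSE of an isomorphism over `G`: a continuous bijection of profinite (compact Hausdorff)
groups has a continuous inverse, which again lies over `G`. [cite: MochizukiTopics2003, Thm 4.12 p.44] -/
def inv (φ : HomOver A B) (h : φ.IsIso) : HomOver B A where
  toHom :=
    { toMonoidHom := h.mulEquiv.symm.toMonoidHom
      continuous_toFun :=
        (Continuous.homeoOfEquivCompactToT2 (f := h.mulEquiv.toEquiv)
          φ.toHom.continuous).continuous_symm }
  «over» := fun y => by
    obtain ⟨x, rfl⟩ := h.2 y
    change A.aug (h.mulEquiv.symm (h.mulEquiv x)) = B.aug (φ.toHom x)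
    rw [MulEquiv.symm_apply_apply, φ.over]

/-- `φ⁻¹ (φ x) = x`. [cite: MochizukiTopics2003, Thm 4.12 p.44] -/
@[simp] theorem inv_apply_apply (φ : HomOver A B) (h : φ.IsIso) (x : A.arith) :
    (φ.inv h).toHom (φ.toHom x) = x :=
  h.mulEquiv.symm_apply_apply x

/-- `φ (φ⁻¹ y) = y`. [cite: MochizukiTopics2003, Thm 4.12 p.44] -/
@[simp] theorem apply_inv_apply (φ : HomOver A B) (h : φ.IsIso) (y : B.arith) :
    φ.toHom ((φ.inv h).toHom y) = y :=
  h.mulEquiv.apply_symm_apply y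

/-- `φ⁻¹ ∘ φ = id`. [cite: MochizukiTopics2003, Thm 4.12 p.44] -/
theorem inv_comp (φ : HomOver A B) (h : φ.IsIso) : (φ.inv h).comp φ = HomOver.id A :=
  HomOver.ext (inv_apply_apply φ h)

/-- `φ ∘ φ⁻¹ = id`. [cite: MochizukiTopics2003, Thm 4.12 p.44] -/
theorem comp_inv (φ : HomOver A B) (h : φ.IsIso) : φ.comp (φ.inv h) = HomOver.id B :=
  HomOver.ext (apply_inv_apply φ h)

/-- The inverse is an isomorphism. [cite: MochizukiTopics2003, Thm 4.12 p.44] -/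
theorem isIso_inv (φ : HomOver A B) (h : φ.IsIso) : (φ.inv h).IsIso :=
  h.mulEquiv.symm.bijective

/-- A homomorphism over `G` with a two-sided inverse UP TO `Δ`-INNER AUTOMORPHISMS is an isomorphism:
if `ψ ∘ φ` is `Δ_A`-conjugate to `id` then `φ` is injective, and if `φ ∘ ψ` is `Δ_B`-conjugate to `id`
then `φ` is surjective. [cite: MochizukiTopics2003, Thm 4.12 p.44] -/
theorem isIso_of_innerEquiv_id {φ : HomOver A B} {ψ : HomOver B A}
    (h₁ : InnerEquiv (ψ.comp φ) (HomOver.id A)) (h₂ : InnerEquiv (φ.comp ψ) (HomOver.id B)) :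
    φ.IsIso := by
  obtain ⟨g, hg, hgc⟩ := h₁
  obtain ⟨g', hg', hgc'⟩ := h₂
  have e₁ : ∀ x, x = g * ψ.toHom (φ.toHom x) * g⁻¹ := fun x => by
    have := congrArg (fun χ : HomOver A A => χ.toHom x) hgc
    simpa only [id_apply, conj_apply, comp_apply] using this
  have e₂ : ∀ y, y = g' * φ.toHom (ψ.toHom y) * g'⁻¹ := fun y => by
    have := congrArg (fun χ : HomOver B B => χ.toHom y) hgc'
    simpa only [id_apply, conj_apply, comp_apply] using this
  constructor
  · intro x y hxy
    rw [e₁ x, e₁ y, hxy]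
  · intro z
    have h3 : ∀ y, φ.toHom (ψ.toHom y) = g'⁻¹ * y * g' := fun y => by
      have hy := e₂ y
      calc φ.toHom (ψ.toHom y) = g'⁻¹ * (g' * φ.toHom (ψ.toHom y) * g'⁻¹) * g' := by group
        _ = g'⁻¹ * y * g' := by rw [← hy]
    exact ⟨ψ.toHom (g' * z * g'⁻¹), by rw [h3]; group⟩

end HomOver

namespace OuterHom

/-- The identity outer homomorphism. [cite: MochizukiLocAn1999, Thm A p.3] -/
protected def id (A : AugmentedProfiniteGrp G) : OuterHom A A := mk (HomOver.id A)

/-- Composition of outer homomorphisms over `G`: well defined on `Δ`-inner classes because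
`(g ψ g⁻¹) ∘ (g' φ g'⁻¹) = (g ψ(g')) (ψ ∘ φ) (g ψ(g'))⁻¹` with `g ψ(g') ∈ Δ_C`
(`HomOver.conj_comp`, `HomOver.comp_conj`, `HomOver.conj_conj`). [cite: MochizukiLocAn1999, Thm A p.3] -/
def comp (d : OuterHom B C) (c : OuterHom A B) : OuterHom A C :=
  Quotient.map₂ (fun (ψ : HomOver B C) (φ : HomOver A B) => ψ.comp φ)
    (fun ψ ψ' hψ φ φ' hφ => by
      obtain ⟨g, hg, rfl⟩ := hψ
      obtain ⟨g', hg', rfl⟩ := hφ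
      refine ⟨g * ψ.toHom g', C.geom.mul_mem hg (ψ.apply_mem_geom hg'), ?_⟩
      rw [HomOver.conj_comp, HomOver.comp_conj, HomOver.conj_conj])
    d c

/-- Composition on representatives. [cite: MochizukiLocAn1999, Thm A p.3] -/
@[simp] theorem mk_comp_mk (ψ : HomOver B C) (φ : HomOver A B) :
    (mk ψ).comp (mk φ) = mk (ψ.comp φ) := rfl

/-- The identity class is the class of the identity. [cite: MochizukiLocAn1999, Thm A p.3] -/
theorem id_eq_mk : OuterHom.id A = mk (HomOver.id A) := rfl

/-- The identity class is an outer isomorphism. [cite: MochizukiTopics2003, Thm 4.12 p.44] -/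
theorem isIso_id : (OuterHom.id A).IsIso := by
  rw [id_eq_mk, isIso_mk]
  exact HomOver.isIso_id

/-- Outer isomorphisms compose. [cite: MochizukiTopics2003, Thm 4.12 p.44] -/
theorem IsIso.comp {d : OuterHom B C} {c : OuterHom A B} (hd : d.IsIso) (hc : c.IsIso) :
    (d.comp c).IsIso := by
  obtain ⟨ψ, rfl⟩ := mk_surjective d
  obtain ⟨φ, rfl⟩ := mk_surjective c
  rw [isIso_mk] at hd hc
  rw [mk_comp_mk, isIso_mk]
  exact hd.comp hc

/-- An outer ISOmorphism is an OPEN outer homomorphism (its image is everything) — the first word of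
"manifestly" in [pGC] p. 3 remark (3). [cite: MochizukiLocAn1999, Thm A p.3] -/
theorem IsIso.isOpen {c : OuterHom A B} (h : c.IsIso) : c.IsOpen := by
  obtain ⟨φ, rfl⟩ := mk_surjective c
  rw [isIso_mk] at h
  rw [isOpen_mk]
  unfold HomOver.IsOpenHom
  rw [Set.range_eq_univ.mpr h.2]
  exact isOpen_univ

/-- An outer isomorphism has a two-sided inverse class, itself an outer isomorphism.
[cite: MochizukiTopics2003, Thm 4.12 p.44] -/
theorem IsIso.exists_inv {c : OuterHom A B} (h : c.IsIso) :
    ∃ c' : OuterHom B A, c'.IsIso ∧ c'.comp c = OuterHom.id A ∧ c.comp c' = OuterHom.id B := by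
  obtain ⟨φ, rfl⟩ := mk_surjective c
  rw [isIso_mk] at h
  refine ⟨mk (φ.inv h), ?_, ?_, ?_⟩
  · rw [isIso_mk]
    exact φ.isIso_inv h
  · rw [mk_comp_mk, φ.inv_comp h, id_eq_mk]
  · rw [mk_comp_mk, φ.comp_inv h, id_eq_mk]

/-- A class with a two-sided inverse class consists of isomorphisms
(`HomOver.isIso_of_innerEquiv_id`). [cite: MochizukiTopics2003, Thm 4.12 p.44] -/
theorem isIso_of_comp_eq_id {c : OuterHom A B} {c' : OuterHom B A}
    (h₁ : c'.comp c = OuterHom.id A) (h₂ : c.comp c' = OuterHom.id B) : c.IsIso := by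
  obtain ⟨φ, rfl⟩ := mk_surjective c
  obtain ⟨ψ, rfl⟩ := mk_surjective c'
  rw [mk_comp_mk, id_eq_mk, mk_eq_mk] at h₁ h₂
  rw [isIso_mk]
  exact HomOver.isIso_of_innerEquiv_id h₁ h₂

end OuterHom

end AugmentedProfiniteGrp

/-! ### Functorial data: [pGC] p. 3 remark (3) as a theorem -/

namespace RelativeAnabelianDatum

open AugmentedProfiniteGrp

variable {G : ProfiniteGrp.{u}} (D : RelativeAnabelianDatum G)

/-- FUNCTORIALITY DATA for a relative anabelian datum `D` ("the natural map" `f ↦ [π₁(f)]` of [pGC]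
Thm A p. 3 is a functor: identities and composites of `K`-morphisms go to identities and composites
of outer homomorphisms over `Γ_K`, and a `K`-morphism is an isomorphism iff it is two-sided
invertible).  Type-valued (it carries the composition law); the étale-`π₁` model supplies it; an
abstract datum need not admit one.  Interface extension of `RelativeAnabelianDatum`, used to turn
remark (3) p. 3 ("manifestly a special case of [...] Theorem A") into a theorem.
[cite: MochizukiLocAn1999, Thm A p.3] -/
structure Functoriality : Type u where
  /-- the identity morphism of an object -/
  id : ∀ X : D.Obj, D.Hom X X
  /-- composition of morphisms (diagrammatic order: `comp f g = g ∘ f`) -/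
  comp : ∀ {X Y Z : D.Obj}, D.Hom X Y → D.Hom Y Z → D.Hom X Z
  /-- `[π₁(id_X)] = [id]` -/
  outerHom_id : ∀ X : D.Obj, D.outerHom (id X) = OuterHom.id (D.grp X)
  /-- `[π₁(g ∘ f)] = [π₁(g)] ∘ [π₁(f)]` -/
  outerHom_comp : ∀ {X Y Z : D.Obj} (f : D.Hom X Y) (g : D.Hom Y Z),
    D.outerHom (comp f g) = (D.outerHom g).comp (D.outerHom f)
  /-- a morphism is an isomorphism iff it has a two-sided inverse -/
  isIso_iff : ∀ {X Y : D.Obj} (f : D.Hom X Y),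
    D.IsIso f ↔ ∃ g : D.Hom Y X, comp f g = id X ∧ comp g f = id Y

variable {D}

/-- For functorial data, `[π₁(f)]` of an isomorphism `f` is an outer isomorphism.
[cite: MochizukiLocAn1999, Thm A p.3] -/
theorem Functoriality.isIso_outerHom (F : D.Functoriality) {X Y : D.Obj} {f : D.Hom X Y}
    (hf : D.IsIso f) : (D.outerHom f).IsIso := by
  obtain ⟨g, hfg, hgf⟩ := (F.isIso_iff f).mp hf
  refine OuterHom.isIso_of_comp_eq_id (c' := D.outerHom g) ?_ ?_
  · rw [← F.outerHom_comp, hfg, F.outerHom_id]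
  · rw [← F.outerHom_comp, hgf, F.outerHom_id]

/-- THE CORE ARGUMENT of [pGC] p. 3 remark (3), for functorial data and any class `P` of objects: if
`f ↦ [π₁(f)]` is a bijection `Hom(X, Y) → {open outer homs}` whenever `X, Y ∈ P` (the hom-version),
then for `X₁, X₂ ∈ P` it restricts to a bijection `Isom(X₁, X₂) → {outer isomorphisms}` (the
isom-version).  Proof: an outer isomorphism `c` is open, so `c = [π₁(f)]` and `c⁻¹ = [π₁(g)]`; then
`[π₁(g ∘ f)] = [id] = [π₁(id)]`, so `g ∘ f = id` by injectivity, and symmetrically; hence `f` is an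
isomorphism. [cite: MochizukiLocAn1999, Thm A p.3] -/
theorem relIsom_of_relHom_on (F : D.Functoriality) (P : D.Obj → Prop)
    (h : ∀ X Y : D.Obj, P X → P Y →
      Set.BijOn (D.outerHom (X := X) (Y := Y)) Set.univ {c | c.IsOpen})
    (X₁ X₂ : D.Obj) (h₁ : P X₁) (h₂ : P X₂) :
    Set.BijOn (D.outerHom (X := X₁) (Y := X₂)) {f | D.IsIso f} {c | c.IsIso} := by
  refine ⟨fun f hf => F.isIso_outerHom hf, (h X₁ X₂ h₁ h₂).2.1.mono (Set.subset_univ _), ?_⟩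
  intro c hc
  change c.IsIso at hc
  obtain ⟨c', hc', h'c, hc'c⟩ := hc.exists_inv
  obtain ⟨f, -, hf⟩ := (h X₁ X₂ h₁ h₂).2.2 (hc.isOpen : c ∈ {c | c.IsOpen})
  obtain ⟨g, -, hg⟩ := (h X₂ X₁ h₂ h₁).2.2 (hc'.isOpen : c' ∈ {c | c.IsOpen})
  refine ⟨f, ?_, hf⟩
  change D.IsIso f
  rw [F.isIso_iff]
  refine ⟨g, ?_, ?_⟩
  · apply (h X₁ X₁ h₁ h₁).2.1 (Set.mem_univ _) (Set.mem_univ _)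
    rw [F.outerHom_comp, hf, hg, h'c, F.outerHom_id]
  · apply (h X₂ X₂ h₂ h₂).2.1 (Set.mem_univ _) (Set.mem_univ _)
    rw [F.outerHom_comp, hf, hg, hc'c, F.outerHom_id]

/-- **[pGC] p. 3 remark (3), PROVED for functorial data**: the relative hom-version GC property of a
datum (`RelHomGC`, the conclusion of [pGC] Thm A) implies its relative isom-version GC property
(`RelIsomGC`, the conclusion shape of [Tpcs] Thm 4.12 / [AbsTopI] Def 4.6 (ii)) — "manifestly a
special case of the profinite version of Theorem A". [cite: MochizukiLocAn1999, Thm A p.3] -/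
theorem relIsomGC_of_relHomGC (F : D.Functoriality) (h : D.RelHomGC) : D.RelIsomGC :=
  fun X₁ X₂ h₁ h₂ =>
    relIsom_of_relHom_on F D.IsHyperbolicCurve (fun X Y _ hY => h X Y hY) X₁ X₂ h₁ h₂

end RelativeAnabelianDatum

/-- **`pGC.ThmA_isom` from `pGC.ThmA`** for FUNCTORIAL data: the isomorphism form of [pGC] Theorem A
over sub-`p`-adic fields (p. 3 remark (3), the tree's named fact `pGC.ThmA_isom`) is a consequence of
Theorem A itself (the named fact `pGC.ThmA`) once "the natural map" is a functor — the in-paper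
reduction, alongside `pGC.thmA_isom_of_thm_4_12` (reduction to the later [Tpcs] Thm 4.12).
[cite: MochizukiLocAn1999, Thm A p.3] -/
theorem pGC.thmA_isom_of_thmA {K : Type u} [Field K] [CharZero K]
    (D : RelativeAnabelianDatum (absoluteGaloisGrp K)) (F : D.Functoriality)
    (h : pGC.ThmA K D) : pGC.ThmA_isom K D :=
  fun hK hprimes => RelativeAnabelianDatum.relIsomGC_of_relHomGC F (h hK hprimes)

namespace AbsTopI.ConstructionDataClass

variable (𝒟 : AbsTopI.ConstructionDataClass.{u})

/-- **rel-hom-DGC ⇒ rel-isom-DGC for a class `𝒟` with functorial data** ([AbsTopI] Def 4.6 (ii)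
p. 55–56; the preamble of Thm 4.7 p. 56 assumes the rel-isom-DGC and (iii) p. 57 "suppose[s]
further that the rel-hom-DGC holds" — for functorial `𝒟` the latter already contains the former,
which is the reading behind the hypothesis list of `Thm_4_7_iii_ofMem` and of [AbsTopI] Example 4.8
(ii) p. 58, where only [pGC] Thm A is cited).  Membership in `𝒟` plays the role of the class `P` of
`RelativeAnabelianDatum.relIsom_of_relHom_on`. [cite: MochizukiAbsTopI2012, Def 4.6 (ii) p.56] -/
theorem relIsomDGC_of_relHomDGC (F : ∀ b : 𝒟.Base, (𝒟.datum b).Functoriality)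
    (h : 𝒟.RelHomDGC) : 𝒟.RelIsomDGC :=
  fun b X₁ X₂ h₁ h₂ =>
    RelativeAnabelianDatum.relIsom_of_relHom_on (F b) (𝒟.Mem b) (h b) X₁ X₂ h₁ h₂

/-- Hence, for a chain-full class with functorial data, the rel-hom-DGC gives BOTH named facts of
[AbsTopI] Example 4.8 at once: `Ex_4_8_ii` (directly, `ex_4_8_ii_of_relHomDGC`) and the rel-isom-DGC
clause of `Ex_4_8_i` (via `relIsomDGC_of_relHomDGC`). [cite: MochizukiAbsTopI2012, Ex 4.8 (ii) p.58] -/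
theorem ex_4_8_i_of_relHomDGC {p : ℕ} [Fact p.Prime] (F : ∀ b : 𝒟.Base, (𝒟.datum b).Functoriality)
    (hfull : 𝒟.IsChainFull) (h : 𝒟.RelHomDGC) : 𝒟.Ex_4_8_i p :=
  𝒟.ex_4_8_i_of_relIsomDGC' hfull (𝒟.relIsomDGC_of_relHomDGC F h)

end AbsTopI.ConstructionDataClass

end Literature.AnabelianGeometry.AbsoluteAnabelian
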